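import Mathlib.MeasureTheory.Function.LpSeminorm.Basic
import Mathlib.MeasureTheory.Function.LpSeminorm.Monotonicity
import Mathlib.MeasureTheory.Function.LpSeminorm.TriangleInequality
import Mathlib.MeasureTheory.Function.StronglyMeasurable.AEStronglyMeasurable
import Mathlib.MeasureTheory.Integral.IntegrableOn
import Mathlib.MeasureTheory.Integral.IntervalIntegral.FundThmCalculus
import Mathlib.MeasureTheory.Measure.Prod
import Literature.Analysis.FluidPDE.ElgindiSelfSimilarEquations
import HarnessLib

/-!
# Non-triviality of the Elgindi–Ghoul–Masmoudi rescaled vorticity from the `𝓗⁰` control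

Topic `Literature/Analysis/FluidPDE`. Proof file (everything proved, no named facts) on the
decomposition path of `Literature.Analysis.FluidPDE.ElgindiGhoulMasmoudi2021_blowupSolution`:
the step "`W(s) = F + ε(s)` stays bounded away from `0` in `L^∞`" by which the stability theorem
of Elgindi–Ghoul–Masmoudi (Camb. J. Math. 9 (2021), §2.5 Thm 2: `𝓔(s) ≤ C𝓔₀e^{−κs}`, hence
`‖W(s) − F‖_{𝓗⁰} → 0`) feeds the Beale–Kato–Majda divergence `∫₀ᵗ‖ω‖_∞ → ∞`
(`λ(s)‖ω(t(s))‖_∞ = sup|W(s)|`, `DynamicRescalingBKM.lean`) — a step the source leaves to the reader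
("from which Theorem 1 and its Corollary follow", p. 9). No `L^∞` embedding of `𝓗ᵏ` is used: the
argument is an `L²` comparison on the fixed box `B = [1, 2] × [π/6, π/3]` inside the quarter
strip, where the `𝓗⁰` weight `w(z)/sin^{η/2}(2θ)` is `≥ 1` (so `‖·‖_{L²(B)} ≤ ‖·‖_{𝓗⁰}`) and the
explicit profile is large: `F_*(z, θ) = (Γ(θ)/c)·4αz/(1+z)² ≥ 4α/9` on `B` for `0 < α ≤ 1`
(`c = ∫₀^{π/2}KΓ ≤ ∫₀^{π/2}K = 1`, `Γ = (sin θ cos²θ)^{α/3} ≥ (1/8)^{1/3} = 1/2` on `[π/6, π/3]`,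
`4z/(1+z)² ≥ 8/9` on `[1, 2]`). If `F` is `𝓗⁰`-close to `aF_*`, `a ≈ 1`, and `W(s)` is `𝓗⁰`-close
to `F`, the triangle inequality in `L²(B)` bounds `sup_{strip}|W(s)|` from below
(`ofReal_le_iSup_of_decay`: `sup|W(s)| ≥ α/9` once `C₀α ≤ 1/2`, `C₀α ≤ √(π/6)/18` and
`‖W(s) − F‖_{𝓗⁰} ≤ (α/18)√(π/6)`).

Sources: [ElgindiGhoulMasmoudi2021] §2.3 (`F = F_* + α²g`), §2.5 Thm 2, §1.7 (the norms);
[Elgindi2021] §1.7.1 (`K`, `Γ`, `1/10 ≤ c ≤ 10`). Used from Mathlib: `eLpNorm` with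
`le_eLpNorm_of_bddBelow`, `eLpNorm_le_of_ae_bound`, `eLpNorm_sub_le`,
`eLpNorm_eq_lintegral_rpow_enorm_toReal`, `ContinuousOn.aestronglyMeasurable`,
`Measure.volume_eq_prod`, `Real.volume_Icc`, `Real.strictMonoOn_sin`, `Real.strictAntiOn_cos`,
`intervalIntegral.integral_eq_sub_of_hasDerivAt`, `intervalIntegral.integral_mono_on`.
-/

noncomputable section

open MeasureTheory Set Function Real
open scoped ENNReal NNReal

namespace Literature.Analysis.FluidPDE

namespace Elgindi

/-! ### The box and the weight -/

/-- The comparison box `B = [1, 2] × [π/6, π/3]` inside the quarter strip. [folklore] -/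
def box : Set (ℝ × ℝ) := Set.Icc 1 2 ×ˢ Set.Icc (π / 6) (π / 3)

/-- The box lies in the open strip. [folklore] -/
theorem box_subset_strip : box ⊆ strip := by
  rintro ⟨z, θ⟩ ⟨hz, hθ⟩
  refine ⟨?_, ?_, ?_⟩
  · exact lt_of_lt_of_le one_pos hz.1
  · exact lt_of_lt_of_le (by positivity) hθ.1
  · exact lt_of_le_of_lt hθ.2 (by linarith [pi_pos])

/-- The box is measurable. [folklore] -/
theorem measurableSet_box : MeasurableSet box :=
  measurableSet_Icc.prod measurableSet_Icc

/-- The box has Lebesgue measure `π/6`. [folklore] -/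
theorem volume_box : volume box = ENNReal.ofReal (π / 6) := by
  rw [box, Measure.volume_eq_prod, Measure.prod_prod, Real.volume_Icc, Real.volume_Icc,
    ← ENNReal.ofReal_mul (by norm_num)]
  congr 1
  ring

/-- The `𝓗⁰` weight dominates `1` in the open strip: `w(z)/sin^{η/2}(2θ) ≥ 1`
(`(1+z)² ≥ z²`, `sin(2θ)^{η/2} ≤ 1`). [folklore] -/
theorem one_le_hWeight {z θ : ℝ} (h : (z, θ) ∈ strip) : 1 ≤ hWeight z θ := by
  obtain ⟨hz, hθ0, hθ1⟩ := h
  have hz' : (0 : ℝ) < z := hz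
  have hs0 : 0 < Real.sin (2 * θ) :=
    Real.sin_pos_of_pos_of_lt_pi (by linarith) (by linarith)
  have hs1 : Real.sin (2 * θ) ^ (eta / 2) ≤ 1 :=
    Real.rpow_le_one hs0.le (Real.sin_le_one _) (div_nonneg eta_pos.le zero_le_two)
  have hspos : 0 < Real.sin (2 * θ) ^ (eta / 2) := Real.rpow_pos_of_pos hs0 _
  have hw : 1 ≤ radialWeight z := by
    unfold radialWeight
    rw [le_div_iff₀ (by positivity)]
    nlinarith
  unfold hWeight
  rw [le_div_iff₀ hspos]
  nlinarith

/-! ### `L²` on the box is controlled by `𝓗⁰` -/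

/-- `∫∫_B |g|² ≤ |g|²_{𝓗⁰}`: the `𝓗⁰` functional integrates `|g·(w/sin^{η/2}(2θ))|²` over the
strip, the weight is `≥ 1` and `B ⊆ strip`. [folklore] -/
theorem lintegral_box_le_eHkNormSq (α : ℝ) (g : ℝ → ℝ → ℝ) :
    ∫⁻ q in box, ‖g q.1 q.2‖ₑ ^ 2 ≤ eHkNormSq α 0 g := by
  rw [eHkNormSq_zero_order]
  unfold eL2Sq hkRadialTerm
  simp only [Function.iterate_zero, id_eq]
  calc ∫⁻ q in box, ‖g q.1 q.2‖ₑ ^ 2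
      ≤ ∫⁻ q in box, ‖g q.1 q.2 * hWeight q.1 q.2‖ₑ ^ 2 := by
        refine setLIntegral_mono' measurableSet_box fun q hq => ?_
        have h1 := one_le_hWeight (box_subset_strip hq)
        have h1' : (1 : ℝ≥0∞) ≤ ‖hWeight q.1 q.2‖ₑ := by
          rw [Real.enorm_eq_ofReal (zero_le_one.trans h1), ← ENNReal.ofReal_one]
          exact ENNReal.ofReal_le_ofReal h1
        rw [enorm_mul]
        gcongr
        exact le_mul_of_one_le_right zero_le h1'
    _ ≤ ∫⁻ q in strip, ‖g q.1 q.2 * hWeight q.1 q.2‖ₑ ^ 2 := lintegral_mono_set box_subset_strip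

/-- `‖g‖_{L²(B)} ≤ |g|_{𝓗⁰}` in Mathlib's `eLpNorm` for the uncurried function on the box. [folklore] -/
theorem eLpNorm_box_le_eHkNorm (α : ℝ) (g : ℝ → ℝ → ℝ) :
    eLpNorm (fun q : ℝ × ℝ => g q.1 q.2) 2 (volume.restrict box) ≤ eHkNorm α 0 g := by
  rw [eLpNorm_eq_lintegral_rpow_enorm_toReal two_ne_zero ENNReal.ofNat_ne_top]
  unfold eHkNorm
  simp only [ENNReal.toReal_ofNat, ENNReal.rpow_two]
  gcongr
  exact lintegral_box_le_eHkNormSq α g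

/-! ### The explicit profile is large on the box -/

/-- `∫₀^{π/2} K = 1` (`K = 3 sin θ cos²θ = −(cos³θ)'`). [folklore] -/
theorem integral_kernelK : ∫ θ in (0 : ℝ)..(π / 2), kernelK θ = 1 := by
  have hderiv : ∀ θ ∈ uIcc 0 (π / 2), HasDerivAt (fun θ => -Real.cos θ ^ 3) (kernelK θ) θ := by
    intro θ _
    have h := ((Real.hasDerivAt_cos θ).pow 3).neg
    refine h.congr_deriv ?_
    simp only [kernelK]
    ring
  rw [intervalIntegral.integral_eq_sub_of_hasDerivAt hderiv
    (continuous_kernelK.intervalIntegrable _ _)]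
  simp

/-- **`c ≤ 1`**: `c = ∫₀^{π/2} KΓ ≤ ∫₀^{π/2} K = 1` since `0 ≤ Γ ≤ 1` and `K ≥ 0` on `[0, π/2]`
(`α ≥ 0`). [folklore] -/
theorem profileConst_le_one {α : ℝ} (hα : 0 ≤ α) : profileConst α ≤ 1 := by
  rw [← integral_kernelK]
  unfold profileConst
  refine intervalIntegral.integral_mono_on (by positivity)
    ((continuous_kernelK_mul_angularWeight hα).intervalIntegrable _ _)
    (continuous_kernelK.intervalIntegrable _ _) fun θ hθ => ?_
  have hK := kernelK_nonneg hθ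
  have hb1 : Real.sin θ * Real.cos θ ^ 2 ≤ 1 :=
    calc Real.sin θ * Real.cos θ ^ 2 ≤ 1 * 1 :=
          mul_le_mul (Real.sin_le_one θ) (Real.cos_sq_le_one θ) (sq_nonneg _) zero_le_one
      _ = 1 := mul_one 1
  have hΓ : angularWeight α θ ≤ 1 :=
    Real.rpow_le_one (sin_mul_cos_sq_nonneg hθ) hb1 (div_nonneg hα zero_le_three)
  calc kernelK θ * angularWeight α θ ≤ kernelK θ * 1 := mul_le_mul_of_nonneg_left hΓ hK
    _ = kernelK θ := mul_one _

/-- `Γ ≥ 1/2` on `[π/6, π/3]` for `0 ≤ α ≤ 1`: there `sin θ cos²θ ≥ 1/8`, so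
`Γ ≥ (1/8)^{α/3} ≥ (1/8)^{1/3} = 1/2`. [folklore] -/
theorem half_le_angularWeight {α : ℝ} (hα : 0 ≤ α) (hα1 : α ≤ 1) {θ : ℝ}
    (hθ : θ ∈ Set.Icc (π / 6) (π / 3)) : 1 / 2 ≤ angularWeight α θ := by
  have hθ0 : 0 ≤ θ := le_trans (by positivity) hθ.1
  have hθπ2 : θ ≤ π / 2 := hθ.2.trans (by linarith [pi_pos])
  -- `sin θ ≥ 1/2`
  have hsin : 1 / 2 ≤ Real.sin θ := by
    rw [← Real.sin_pi_div_six]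
    exact Real.strictMonoOn_sin.monotoneOn
      ⟨by linarith [pi_pos], by linarith [pi_pos]⟩ ⟨by linarith [pi_pos], hθπ2⟩ hθ.1
  -- `cos θ ≥ 1/2`
  have hcos : 1 / 2 ≤ Real.cos θ := by
    rw [← Real.cos_pi_div_three]
    exact Real.strictAntiOn_cos.antitoneOn ⟨hθ0, by linarith [pi_pos]⟩
      ⟨by positivity, by linarith [pi_pos]⟩ hθ.2
  have hbase : 1 / 8 ≤ Real.sin θ * Real.cos θ ^ 2 := by nlinarith
  have h1 : (1 / 8 : ℝ) ^ (α / 3) ≤ (Real.sin θ * Real.cos θ ^ 2) ^ (α / 3) :=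
    Real.rpow_le_rpow (by norm_num) hbase (div_nonneg hα zero_le_three)
  have h2 : (1 / 8 : ℝ) ^ ((1 : ℝ) / 3) ≤ (1 / 8 : ℝ) ^ (α / 3) :=
    Real.rpow_le_rpow_of_exponent_ge (by norm_num) (by norm_num)
      (div_le_div_of_nonneg_right hα1 zero_le_three)
  have h3 : (1 / 8 : ℝ) ^ ((1 : ℝ) / 3) = 1 / 2 := by
    rw [show (1 / 8 : ℝ) = (1 / 2) ^ (3 : ℕ) by norm_num, ← Real.rpow_natCast,
      ← Real.rpow_mul (by norm_num)]
    norm_num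
  unfold angularWeight
  linarith

/-- The radial factor: `4z/(1+z)² ≥ 8/9` on `[1, 2]`. [folklore] -/
theorem radial_factor_ge {z : ℝ} (hz : z ∈ Set.Icc (1 : ℝ) 2) : 8 / 9 ≤ 4 * z / (1 + z) ^ 2 := by
  have h1 : 0 < (1 + z) ^ 2 := by nlinarith [hz.1]
  rw [le_div_iff₀ h1]
  nlinarith [hz.1, hz.2]

/-- **`F_* ≥ 4α/9` on the box** for `0 < α ≤ 1`. [folklore] -/
theorem fundamentalProfile_ge_on_box {α : ℝ} (hα : 0 < α) (hα1 : α ≤ 1) {z θ : ℝ}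
    (h : (z, θ) ∈ box) : 4 * α / 9 ≤ fundamentalProfile α z θ := by
  obtain ⟨hz, hθ⟩ := h
  have hc0 := profileConst_pos hα.le
  have hc1 := profileConst_le_one hα.le
  have hΓ := half_le_angularWeight hα.le hα1 hθ
  have hr := radial_factor_ge hz
  have hq : 1 / 2 ≤ angularWeight α θ / profileConst α := by
    rw [le_div_iff₀ hc0]
    nlinarith
  have hr' : 0 ≤ 4 * α * z / (1 + z) ^ 2 := by
    have : 0 ≤ z := zero_le_one.trans hz.1
    positivity
  unfold fundamentalProfile
  calc 4 * α / 9 = 1 / 2 * (α * (8 / 9)) := by ring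
    _ ≤ angularWeight α θ / profileConst α * (α * (4 * z / (1 + z) ^ 2)) := by
        apply mul_le_mul hq (mul_le_mul_of_nonneg_left hr hα.le) (by positivity)
        exact le_trans (by norm_num) hq
    _ = angularWeight α θ / profileConst α * (4 * α * z / (1 + z) ^ 2) := by ring

/-- Continuity of `F_*` on the box (the denominator `(1+z)²` does not vanish there). [folklore] -/
theorem continuousOn_fundamentalProfile_box {α : ℝ} (hα : 0 ≤ α) :
    ContinuousOn (fun q : ℝ × ℝ => fundamentalProfile α q.1 q.2) box := by
  have h1 : ContinuousOn (fun q : ℝ × ℝ => angularWeight α q.2 / profileConst α) box :=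
    ((continuous_angularWeight hα).comp continuous_snd).continuousOn.div_const _
  have h2 : ContinuousOn (fun q : ℝ × ℝ => 4 * α * q.1 / (1 + q.1) ^ 2) box := by
    refine ContinuousOn.div (by fun_prop) (by fun_prop) fun q hq => ?_
    have : (1 : ℝ) ≤ q.1 := hq.1.1
    positivity
  exact h1.mul h2

/-! ### The non-triviality estimate -/

/-- **`L²(B)` lower bound for `aF_*`**: if `a ≥ 1/2` and `0 < α ≤ 1` then
`‖aF_*‖_{L²(B)} ≥ (2α/9)·|B|^{1/2}`. [folklore] -/
theorem le_eLpNorm_smul_fundamentalProfile {α a : ℝ} (hα : 0 < α) (hα1 : α ≤ 1) (ha : 1 / 2 ≤ a) :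
    ENNReal.ofReal (2 * α / 9) * volume box ^ (1 / 2 : ℝ) ≤
      eLpNorm (fun q : ℝ × ℝ => (a • fundamentalProfile α) q.1 q.2) 2 (volume.restrict box) := by
  have key := le_eLpNorm_of_bddBelow (μ := volume.restrict box) (p := (2 : ℝ≥0∞)) two_ne_zero
    ENNReal.ofNat_ne_top (f := fun q : ℝ × ℝ => (a • fundamentalProfile α) q.1 q.2)
    (Real.toNNReal (2 * α / 9)) measurableSet_box (ae_of_all _ fun q hq => ?_)
  · rw [Measure.restrict_apply measurableSet_box, Set.inter_self, ENNReal.smul_def, smul_eq_mul,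
      ENNReal.toReal_ofNat] at key
    exact key
  · have hF := fundamentalProfile_ge_on_box hα hα1 hq
    have hpos : 0 ≤ a * fundamentalProfile α q.1 q.2 := by
      have : 0 ≤ fundamentalProfile α q.1 q.2 := le_trans (by positivity) hF
      exact mul_nonneg (le_trans (by norm_num) ha) this
    rw [Real.toNNReal_le_iff_le_coe, coe_nnnorm, Pi.smul_apply, Pi.smul_apply, smul_eq_mul,
      Real.norm_of_nonneg hpos]
    nlinarith

/-- **Non-triviality of the rescaled vorticity.** Let `0 < α ≤ 1`, `|a − 1| ≤ C₀α` with
`C₀α ≤ 1/2` and `C₀α ≤ √(π/6)/18`, let `F` be continuous in the open strip with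
`|F − aF_*|_{𝓗⁰} ≤ C₀α²`, and let `W` be continuous in the open strip with `|W − F|_{𝓗⁰} ≤ E`,
`E ≤ (α/18)√(π/6)`. Then `sup_{strip}|W| ≥ α/9`. Proof: `L²` on `B = [1,2] × [π/6,π/3]`,
`(2α/9)|B|^{1/2} ≤ ‖aF_*‖ ≤ ‖W‖ + ‖W − F‖ + ‖F − aF_*‖ ≤ |B|^{1/2} sup|W| + E + C₀α²`,
`|B| = π/6`. For the Elgindi–Ghoul–Masmoudi solution (`‖W(s) − F‖_{𝓗⁰} ≤ Ce^{−κs}`) this holds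
for all large `s`. [folklore] -/
theorem ofReal_le_iSup_of_decay {α C₀ a E : ℝ} (hα : 0 < α) (hα1 : α ≤ 1) (hC₀ : 0 ≤ C₀)
    (ha : |a - 1| ≤ C₀ * α) (hC₀α : C₀ * α ≤ 1 / 2)
    (hsmall : C₀ * α ≤ Real.sqrt (π / 6) / 18) {F : ℝ → ℝ → ℝ}
    (hF : ContinuousOn (uncurry F) strip)
    (hFa : eHkNorm α 0 (F - a • fundamentalProfile α) ≤ ENNReal.ofReal (C₀ * α ^ 2))
    {W : ℝ → ℝ → ℝ} (hW : ContinuousOn (uncurry W) strip) (hE0 : 0 ≤ E)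
    (hWF : eHkNorm α 0 (W - F) ≤ ENNReal.ofReal E) (hE : E ≤ α / 18 * Real.sqrt (π / 6)) :
    ENNReal.ofReal (α / 9) ≤ ⨆ q : strip, ‖W q.1.1 q.1.2‖ₑ := by
  set S : ℝ≥0∞ := ⨆ q : strip, ‖W q.1.1 q.1.2‖ₑ with hS
  rcases eq_or_ne S ∞ with hStop | hStop
  · rw [hStop]; exact le_top
  -- the players, as functions on `ℝ × ℝ` with the measure restricted to the box
  set μB : Measure (ℝ × ℝ) := volume.restrict box with hμB
  set fW : ℝ × ℝ → ℝ := fun q => W q.1 q.2 with hfW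
  set fF : ℝ × ℝ → ℝ := fun q => F q.1 q.2 with hfF
  set fS : ℝ × ℝ → ℝ := fun q => (a • fundamentalProfile α) q.1 q.2 with hfS
  have ha2 : 1 / 2 ≤ a := by
    have := (abs_le.1 ha).1
    linarith
  -- measurability on the box
  have hWm : AEStronglyMeasurable fW μB :=
    (hW.mono box_subset_strip).aestronglyMeasurable measurableSet_box
  have hFm : AEStronglyMeasurable fF μB :=
    (hF.mono box_subset_strip).aestronglyMeasurable measurableSet_box
  have hSm : AEStronglyMeasurable fS μB := by
    have h := (continuousOn_fundamentalProfile_box hα.le).aestronglyMeasurable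
      (μ := volume) measurableSet_box
    have e : fS = fun q => a * fundamentalProfile α q.1 q.2 := by
      funext q; simp [hfS, smul_eq_mul]
    rw [e]
    exact h.const_mul a
  -- the volume of the box
  have hV : volume box ^ (1 / 2 : ℝ) = ENNReal.ofReal (Real.sqrt (π / 6)) := by
    rw [volume_box, Real.sqrt_eq_rpow, ENNReal.ofReal_rpow_of_nonneg (by positivity) (by norm_num)]
  have hVuniv : μB Set.univ = volume box := by
    rw [hμB, Measure.restrict_apply MeasurableSet.univ, Set.univ_inter]
  -- (1) lower bound for `a F_*`
  have h1 : ENNReal.ofReal (2 * α / 9) * ENNReal.ofReal (Real.sqrt (π / 6)) ≤ eLpNorm fS 2 μB := by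
    rw [← hV]
    exact le_eLpNorm_smul_fundamentalProfile hα hα1 ha2
  -- (2) triangle inequality: `aF_* = W − (W − F) − (F − aF_*)`
  have h2 : eLpNorm fS 2 μB ≤
      eLpNorm fW 2 μB + eLpNorm (fW - fF) 2 μB + eLpNorm (fF - fS) 2 μB := by
    have e : fS = fW - (fW - fF) - (fF - fS) := by
      funext q
      simp only [Pi.sub_apply]
      ring
    calc eLpNorm fS 2 μB = eLpNorm (fW - (fW - fF) - (fF - fS)) 2 μB := by rw [← e]
      _ ≤ eLpNorm (fW - (fW - fF)) 2 μB + eLpNorm (fF - fS) 2 μB :=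
          eLpNorm_sub_le (hWm.sub (hWm.sub hFm)) (hFm.sub hSm) one_le_two
      _ ≤ eLpNorm fW 2 μB + eLpNorm (fW - fF) 2 μB + eLpNorm (fF - fS) 2 μB := by
          gcongr
          exact eLpNorm_sub_le hWm (hWm.sub hFm) one_le_two
  -- (3) `W` on the box is bounded by its sup over the strip
  have h3 : eLpNorm fW 2 μB ≤ ENNReal.ofReal (Real.sqrt (π / 6)) * ENNReal.ofReal S.toReal := by
    have hb : ∀ᵐ q ∂μB, ‖fW q‖ ≤ S.toReal := by
      rw [hμB, ae_restrict_iff' measurableSet_box]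
      refine ae_of_all _ fun q hq => ?_
      have hle : ‖W q.1 q.2‖ₑ ≤ S := le_iSup (fun q : strip => ‖W q.1.1 q.1.2‖ₑ)
        ⟨q, box_subset_strip hq⟩
      rw [← ofReal_norm] at hle
      rw [← ENNReal.ofReal_le_ofReal_iff ENNReal.toReal_nonneg, ENNReal.ofReal_toReal hStop]
      exact hle
    have := eLpNorm_le_of_ae_bound (p := (2 : ℝ≥0∞)) hb
    rwa [hVuniv, ENNReal.toReal_ofNat, ← one_div, hV] at this
  -- (4) the two `𝓗⁰` bounds
  have h4 : eLpNorm (fW - fF) 2 μB ≤ ENNReal.ofReal E := by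
    have := eLpNorm_box_le_eHkNorm α (W - F)
    exact le_trans (le_of_eq rfl) (this.trans hWF)
  have h5 : eLpNorm (fF - fS) 2 μB ≤ ENNReal.ofReal (C₀ * α ^ 2) := by
    have := eLpNorm_box_le_eHkNorm α (F - a • fundamentalProfile α)
    exact le_trans (le_of_eq rfl) (this.trans hFa)
  -- (5) combine in `ℝ`
  have hv : 0 < Real.sqrt (π / 6) := Real.sqrt_pos.2 (by positivity)
  have hchain : ENNReal.ofReal (2 * α / 9 * Real.sqrt (π / 6)) ≤
      ENNReal.ofReal (Real.sqrt (π / 6) * S.toReal + E + C₀ * α ^ 2) := by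
    rw [ENNReal.ofReal_mul (by positivity)]
    refine h1.trans (h2.trans ?_)
    rw [ENNReal.ofReal_add (by positivity) (by positivity),
      ENNReal.ofReal_add (by positivity) hE0, ENNReal.ofReal_mul hv.le]
    gcongr
  have hreal : 2 * α / 9 * Real.sqrt (π / 6) ≤ Real.sqrt (π / 6) * S.toReal + E + C₀ * α ^ 2 :=
    (ENNReal.ofReal_le_ofReal_iff (by positivity)).1 hchain
  have hC₀α2 : C₀ * α ^ 2 ≤ α / 18 * Real.sqrt (π / 6) := by
    have : C₀ * α ^ 2 = (C₀ * α) * α := by ring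
    rw [this]
    nlinarith
  have hSr : α / 9 ≤ S.toReal := by
    by_contra hlt
    rw [not_le] at hlt
    nlinarith
  calc ENNReal.ofReal (α / 9) ≤ ENNReal.ofReal S.toReal := ENNReal.ofReal_le_ofReal hSr
    _ = S := ENNReal.ofReal_toReal hStop

end Elgindi

end Literature.Analysis.FluidPDE
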